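import Summits.CriticalPhenomena.PercolationContinuityZ3.Theorems.Transplant.FKConnectivityAllQTwoCluster
import Summits.CriticalPhenomena.PercolationContinuityZ3.Theorems.Transplant.FKConnectivityAllQClusterDom
import Summits.CriticalPhenomena.PercolationContinuityZ3.Theorems.PercNearOneGluingNoHeavyLowerTailFKExactEval
import HarnessLib

/-!
# The TWO-CLUSTER LAW is positively associated (node `TwoClusterAssocPos`, NOT asserted) ⇒ the two-cluster four-point inequality;
# its AVOIDANCE-conditioned form (the two-cluster analogue of van den Berg–Häggström–Kahn Thm. 1.2 with `|X| = 2`) is FALSE (kernel)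

Support file (`--supports stmt-CriticalPhenomena-4575`), FK sub-lane `prim-bschramm-fk-1` (gen 13) of the post-continuity programme;
builds on p205010 (kernel theorem, internal audit signed; external expert review pending).  Definitions (`twoClusterEv`, `avoidEv`,
`TwoClusterAssocOn`, `TwoClusterAvoidAssocOn`, one `@[conjecture]` node — NOT asserted), one listed weighted graph decided by
`decide +kernel`; no named facts, no sorries; standard axioms.

THE OBJECT.  Bernoulli percolation `P_w` on a finite weighted graph conditioned on the event `E_{a,c} = {a ↮ c} ∩ {k = 2}`
("exactly two open clusters, separating `a` from `c`"; `twoClusterEv`).  On `E_{a,c}` the cluster `S = C_a` determines everything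
(`C_c = V ∖ S`, `reachable_iff_not_reachable_of_mem_twoClusterEv`), and its law is the TWO-CLUSTER LAW
`ν(S) ∝ c_w(S)·c_w(V∖S)·∏_{e ∈ ∂S}(1 − w_e) ∝ C_S(x)·C_{V∖S}(x)`, `x_e = w_e/(1 − w_e)`, `C_S` = generating polynomial of the
connected spanning subgraphs of `G[S]` (fk-1 g12/g13 memos).  It is the `q → 0⁺` corner (at fixed edge parameters) of `φ_{w,q}(· | a ↮ c)`,
and Kozma–Nitzan's four-point inequality for every `φ_{w,q}` forces the TWO-CLUSTER FOUR-POINT inequality `TwoClusterFourPointOn`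
(`…AllQTwoCluster.lean`, `twoClusterFourPointPos_of_fourPointFKPos`).

THIS FILE.
* `TwoClusterAssocOn V` — **positive association of `C_a` under the two-cluster law** (CA₂): for up-sets `𝒰, 𝒱` of vertex sets,
  `P(C_a ∈ 𝒰, E)·P(C_a ∈ 𝒱, E) ≤ P(C_a ∈ 𝒰 ∩ 𝒱, E)·P(E)`, `E = E_{a,c}`; node `TwoClusterAssocPos` (`∀ Fin n`; NOT asserted).
* **`twoClusterFourPointOn_of_assocOn : TwoClusterAssocOn V → TwoClusterFourPointOn V`** (kernel; `𝒰 = {S ∋ o}`, `𝒱 = {S ∋ b}` and the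
  algebra `(x₃+x₆)(x₃+x₇) ≤ x₃(x₃+x₄+x₆+x₇) ⟺ x₆x₇ ≤ x₃x₄`), `twoClusterFourPointPos_of_assocPos`.
* `TwoClusterAvoidAssocOn V` — the same with `{a ↮ c}` replaced by `{a ↮ X}` for a SET `X` (`avoidEv`), i.e. positive association of `C_a`
  given `{a ↮ X} ∩ {k = 2}` — the literal two-cluster analogue of van den Berg–Häggström–Kahn's Theorem 1.2
  (`Pr(AB | s ↮ X) ≥ Pr(A | s ↮ X)Pr(B | s ↮ X)` for Bernoulli percolation WITHOUT the level constraint, any `X`).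
  **`not_twoClusterAvoidAssocOn_fin_five`** (kernel, `decide +kernel` on the 64 configurations of `K_{2,3}`, all parameters `1/2`):
  with apexes `0, 1`, leaves `2, 3, 4`, `a = 2`, `X = {3, 4}`: `P(0 ∈ C_a, 1 ∈ C_a, a ↮ X, k = 2) = 0` (the complement `{3,4}` of
  `{0,1,2}` is not connected) while `P(0 ∈ C_a, a ↮ X, k = 2) = P(1 ∈ C_a, a ↮ X, k = 2) = 1/64 > 0`: given that the leaf `4` lies in
  the other cluster, the two apexes are NEGATIVELY correlated members of `C_a`.  So `|X| = 1` (CA₂, census-true) is the most one can ask: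
  conditioning the two-cluster law on a further decreasing (or increasing, by the `a ↔ c` symmetry) cylinder event of `C_a` destroys
  positive association — in particular CA₂ admits NO proof by site-by-site conditioning / Holley's criterion (its single-site conditional
  laws are not stochastically ordered once a second site is pinned), in contrast with vdBHK's inductive proof of their Thm. 1.1.
EVIDENCE for the node (fk-1 g13, exact rationals, memo bschramm/FROM-fk-1-g13-TWO-CLUSTER.md): all connected graphs on 4 and 5 vertices
× 3 weight palettes × all `(a,c)`, and 1,500 random weighted graphs on 6 vertices (5 palettes incl. near-deterministic): CA₂ holds for ALL
pairs of up-sets (0 violations / 1,431,937 pairs; Dedekind families), the single-site form `ν(· | v ∈ S) ⪰ ν(· | v ∉ S)` 0 / 461,972,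
the four-point form 0 / 150,300 (+ n = 7, 8, 9 samples, principal/hitting up-sets, 0 violations); the FKG lattice condition for `ν` FAILS
(5,048 pairs: the support {S : G[S], G[V∖S] connected} is not a sublattice); CA₂ is PROVED on paper on every double cone `K_{2,m}`
(mixture of two product measures plus the two degenerate cuts; memo §2) — the family on which `ClusterAssocFKPos` (CA for `φ_{w,q}`,
`q < 1`) FAILS at `m = 34` (`FK.not_clusterAssocFKPos`); corners: `x → 0` (uniform spanning two-forests; the four-point form is Wilson's
algorithm + `{τ_a < τ_c} ⊆ {τ_{γ∪a} < τ_c}`, fk-1 g12) and `x → ∞` with equal parameters (uniform measure on the distributive lattice of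
minimum `a–c` cuts: FKG).
[cite: VandenbergHaggstromKahn2005, Thm. 1.2 (p. 5); Thm. 1.5 (p. 7)] [cite: KozmaNitzan2024, Thm. 1, eq. (6) (pp. 7–8)]
[cite: Grimmett2006, §1.2 eq. (1.1) (p. 4); §3.9 (pp. 63–65)]
-/

noncomputable section

namespace Summit.CriticalPhenomena.PercolationContinuityZ3.Theorems

namespace FK

open MeasureTheory Set Literature.Probability.LatticeModels Literature.Probability.Percolation
open scoped Classical

variable {V : Type*} [Fintype V]

/-! ### The two-cluster event and the structure of its configurations -/

/-- **The two-cluster event** `E_{a,c} = {a ↮ c} ∩ {k = 2}`: exactly two open clusters, `a` and `c` in different ones.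
[cite: Grimmett2006, §1.2 eq. (1.1) (p. 4)] -/
def twoClusterEv (a c : V) : Set (BondConfig V) := sepEv a c ∩ levelSet V 2

/-- **Avoidance of a set**: `{a ↮ X} = {a ↮ x ∀ x ∈ X}` (vdBHK's `R_X`). [cite: VandenbergHaggstromKahn2005, §1 (p. 3)] -/
def avoidEv (a : V) (X : Set V) : Set (BondConfig V) := {ω | ∀ x ∈ X, ¬ (openGraph ω).Reachable a x}

omit [Fintype V] in
/-- `{a ↮ {c}} = {a ↮ c}`. [cite: VandenbergHaggstromKahn2005, §1 (p. 3)] -/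
theorem avoidEv_singleton (a c : V) : (avoidEv a ({c} : Set V) : Set (BondConfig V)) = sepEv a c := by
  ext ω; simp [avoidEv, mem_sepEv_iff]

omit [Fintype V] in
/-- Membership unfolding for `twoClusterEv`. [folklore] -/
theorem mem_twoClusterEv_iff [Fintype V] (a c : V) (ω : BondConfig V) :
    ω ∈ twoClusterEv a c ↔ ¬ (openGraph ω).Reachable a c ∧ clusterCount ω ∅ = 2 := Iff.rfl

/-- **On the two-cluster event every vertex lies in exactly one of `C_a`, `C_c`**: `b ↔ c ↔ ¬ (b ↔ a)`.
[cite: Grimmett2006, §1.2 eq. (1.1) (p. 4)] -/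
theorem reachable_iff_not_reachable_of_mem_twoClusterEv {ω : BondConfig V} {a c : V} (hω : ω ∈ twoClusterEv a c) (b : V) :
    (openGraph ω).Reachable b c ↔ ¬ (openGraph ω).Reachable b a := by
  obtain ⟨hsep, hL⟩ := hω
  rw [mem_sepEv_iff] at hsep
  rw [mem_levelSet_iff] at hL
  unfold clusterCount at hL
  rw [wired_empty, sup_bot_eq] at hL
  set G := openGraph ω
  refine ⟨fun hbc hba => hsep (hba.symm.trans hbc), fun hba => ?_⟩
  obtain ⟨y, -, huniq⟩ := (Nat.card_eq_two_iff' (G.connectedComponentMk a)).1 hL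
  have hc : G.connectedComponentMk c = y :=
    huniq _ fun h => hsep (SimpleGraph.ConnectedComponent.eq.1 h).symm
  have hb : G.connectedComponentMk b = y :=
    huniq _ fun h => hba (SimpleGraph.ConnectedComponent.eq.1 h)
  exact SimpleGraph.ConnectedComponent.eq.1 (hb.trans hc.symm)

/-- On the two-cluster event, `{b ↔ c} = {b ↔ a}ᶜ` as events. [cite: Grimmett2006, §1.2 eq. (1.1) (p. 4)] -/
theorem openConn_inter_twoClusterEv_eq_compl (a c b : V) :
    (openConn b c ∩ twoClusterEv a c : Set (BondConfig V)) = (openConn b a)ᶜ ∩ twoClusterEv a c := by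
  ext ω
  simp only [mem_inter_iff, mem_compl_iff, mem_openConn_iff']
  constructor
  · rintro ⟨hbc, hE⟩; exact ⟨(reachable_iff_not_reachable_of_mem_twoClusterEv hE b).1 hbc, hE⟩
  · rintro ⟨hba, hE⟩; exact ⟨(reachable_iff_not_reachable_of_mem_twoClusterEv hE b).2 hba, hE⟩

/-! ### Positive association of the two-cluster law (node) -/

/-- **Positive association of `C_a` under the two-cluster law** (CA₂) on the vertex type `V`: for all weights, all `a, c` and all up-sets
`𝒰, 𝒱` of vertex sets, `P(C_a ∈ 𝒰, E)·P(C_a ∈ 𝒱, E) ≤ P(C_a ∈ 𝒰 ∩ 𝒱, E)·P(E)` with `E = {a ↮ c} ∩ {k = 2}` — i.e. the law of `C_a` under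
`P_w(· | E)` is positively associated.  The two-cluster analogue of vdBHK Thm. 1.2 / 1.5 with a single avoided vertex.
[cite: VandenbergHaggstromKahn2005, Thm. 1.2 (p. 5); Thm. 1.5 (p. 7)] [cite: Grimmett2006, §1.2 eq. (1.1) (p. 4)] -/
def TwoClusterAssocOn (V : Type*) [Fintype V] : Prop :=
  ∀ (w : Sym2 V → unitInterval) (a c : V) (𝒰 𝒱 : Set (Set V)), IsUpperSet 𝒰 → IsUpperSet 𝒱 →
    (prodBernoulli w).real (clusterIn a 𝒰 ∩ twoClusterEv a c) * (prodBernoulli w).real (clusterIn a 𝒱 ∩ twoClusterEv a c) ≤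
      (prodBernoulli w).real (clusterIn a 𝒰 ∩ clusterIn a 𝒱 ∩ twoClusterEv a c) * (prodBernoulli w).real (twoClusterEv a c)

/-- **CA₂ on every finite weighted graph.**  CONJECTURE-SHAPED STATEMENT, NOT asserted.  Evidence (fk-1 g13, exact): all pairs of up-sets
on all weighted graphs with `≤ 6` vertices tested (0 / 1,431,937), samples on 7–9 vertices, every double cone `K_{2,m}` (paper proof), the
corners `x → 0` (two-forests / Wilson) and `x → ∞` (min-cut lattice / FKG); the avoidance-conditioned strengthening is FALSE
(`not_twoClusterAvoidAssocOn_fin_five`) and the FKG lattice condition fails.  Implies `TwoClusterFourPointPos`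
(`twoClusterFourPointPos_of_assocPos`). [cite: VandenbergHaggstromKahn2005, Thm. 1.5 (p. 7)] [cite: Grimmett2006, §3.9 (pp. 63–65)] -/
@[conjecture] def TwoClusterAssocPos : Prop := ∀ n : ℕ, TwoClusterAssocOn (Fin n)

omit [Fintype V] in
/-- The principal up-set `{S | o ∈ S}` is an up-set. [folklore] -/
theorem isUpperSet_mem (o : V) : IsUpperSet ({S | o ∈ S} : Set (Set V)) := fun _ _ hST h => hST h

omit [Fintype V] in
/-- `{C_a ∋ o} = {o ↔ a}`. [folklore] -/
theorem clusterIn_mem_eq_openConn' (a o : V) : (clusterIn a {S | o ∈ S} : Set (BondConfig V)) = openConn o a := by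
  rw [clusterIn_mem_eq_openConn, openConn_comm]

/-- **CA₂ ⇒ the two-cluster four-point inequality** (`𝒰 = {S ∋ o}`, `𝒱 = {S ∋ b}`; on `E`, `b ↔ c` iff `b ∉ C_a`).
[cite: KozmaNitzan2024, Thm. 1, eq. (6) (pp. 7–8)] [cite: VandenbergHaggstromKahn2005, Thm. 1.5 (p. 7)] -/
theorem twoClusterFourPointOn_of_assocOn (h : TwoClusterAssocOn V) : TwoClusterFourPointOn V := by
  intro w o a c b
  have hmW : MeasurableSet (openConn b a : Set (BondConfig V)) := measurableSet_bond _
  have hmU : MeasurableSet (openConn o a : Set (BondConfig V)) := measurableSet_bond _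
  -- the four pattern events in terms of `U = {o ↔ a}`, `W = {b ↔ a}` and `E = twoClusterEv a c`
  have e3 : (openConn o a ∩ openConn b a ∩ sepEv a c ∩ levelSet V 2 : Set (BondConfig V)) =
      openConn o a ∩ openConn b a ∩ twoClusterEv a c := by
    rw [inter_assoc (openConn o a ∩ openConn b a)]; rfl
  have e6 : (openConn o a ∩ openConn b c ∩ sepEv a c ∩ levelSet V 2 : Set (BondConfig V)) =
      (openConn o a ∩ twoClusterEv a c) \ openConn b a := by
    ext ω
    simp only [mem_inter_iff, mem_sdiff, mem_openConn_iff']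
    constructor
    · rintro ⟨⟨⟨hoa, hbc⟩, hs⟩, hl⟩
      have hE : ω ∈ twoClusterEv a c := ⟨hs, hl⟩
      exact ⟨⟨hoa, hE⟩, (reachable_iff_not_reachable_of_mem_twoClusterEv hE b).1 hbc⟩
    · rintro ⟨⟨hoa, hE⟩, hba⟩
      exact ⟨⟨⟨hoa, (reachable_iff_not_reachable_of_mem_twoClusterEv hE b).2 hba⟩, hE.1⟩, hE.2⟩
  have e7 : (openConn o c ∩ openConn b a ∩ sepEv a c ∩ levelSet V 2 : Set (BondConfig V)) =
      (openConn b a ∩ twoClusterEv a c) \ openConn o a := by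
    ext ω
    simp only [mem_inter_iff, mem_sdiff, mem_openConn_iff']
    constructor
    · rintro ⟨⟨⟨hoc, hba⟩, hs⟩, hl⟩
      have hE : ω ∈ twoClusterEv a c := ⟨hs, hl⟩
      exact ⟨⟨hba, hE⟩, (reachable_iff_not_reachable_of_mem_twoClusterEv hE o).1 hoc⟩
    · rintro ⟨⟨hba, hE⟩, hoa⟩
      exact ⟨⟨⟨(reachable_iff_not_reachable_of_mem_twoClusterEv hE o).2 hoa, hba⟩, hE.1⟩, hE.2⟩
  have e4 : (openConn o c ∩ openConn b c ∩ sepEv a c ∩ levelSet V 2 : Set (BondConfig V)) =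
      (twoClusterEv a c \ openConn o a) \ openConn b a := by
    ext ω
    simp only [mem_inter_iff, mem_sdiff, mem_openConn_iff']
    constructor
    · rintro ⟨⟨⟨hoc, hbc⟩, hs⟩, hl⟩
      have hE : ω ∈ twoClusterEv a c := ⟨hs, hl⟩
      exact ⟨⟨hE, (reachable_iff_not_reachable_of_mem_twoClusterEv hE o).1 hoc⟩,
        (reachable_iff_not_reachable_of_mem_twoClusterEv hE b).1 hbc⟩
    · rintro ⟨⟨hE, hoa⟩, hba⟩
      exact ⟨⟨⟨(reachable_iff_not_reachable_of_mem_twoClusterEv hE o).2 hoa,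
        (reachable_iff_not_reachable_of_mem_twoClusterEv hE b).2 hba⟩, hE.1⟩, hE.2⟩
  rw [e3, e6, e7, e4]
  -- CA₂ for the principal up-sets of `o` and `b`
  have key := h w a c {S | o ∈ S} {S | b ∈ S} (isUpperSet_mem o) (isUpperSet_mem b)
  rw [clusterIn_mem_eq_openConn' a o, clusterIn_mem_eq_openConn' a b] at key
  -- decompose the masses
  have s1 : (prodBernoulli w).real (openConn o a ∩ twoClusterEv a c) =
      (prodBernoulli w).real (openConn o a ∩ openConn b a ∩ twoClusterEv a c) +
        (prodBernoulli w).real ((openConn o a ∩ twoClusterEv a c) \ openConn b a) := by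
    rw [← measureReal_inter_add_sdiff (μ := prodBernoulli w) (s := openConn o a ∩ twoClusterEv a c) hmW]
    congr 1; ac_rfl
  have s2 : (prodBernoulli w).real (openConn b a ∩ twoClusterEv a c) =
      (prodBernoulli w).real (openConn o a ∩ openConn b a ∩ twoClusterEv a c) +
        (prodBernoulli w).real ((openConn b a ∩ twoClusterEv a c) \ openConn o a) := by
    rw [← measureReal_inter_add_sdiff (μ := prodBernoulli w) (s := openConn b a ∩ twoClusterEv a c) hmU]
    congr 1; ac_rfl
  have s3 : (prodBernoulli w).real (twoClusterEv a c) =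
      (prodBernoulli w).real (openConn o a ∩ twoClusterEv a c) + (prodBernoulli w).real (twoClusterEv a c \ openConn o a) := by
    rw [← measureReal_inter_add_sdiff (μ := prodBernoulli w) (s := twoClusterEv a c) hmU, inter_comm]
  have s4 : (prodBernoulli w).real (twoClusterEv a c \ openConn o a) =
      (prodBernoulli w).real ((openConn b a ∩ twoClusterEv a c) \ openConn o a) +
        (prodBernoulli w).real ((twoClusterEv a c \ openConn o a) \ openConn b a) := by
    rw [← measureReal_inter_add_sdiff (μ := prodBernoulli w) (s := twoClusterEv a c \ openConn o a) hmW,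
      show ((twoClusterEv a c \ openConn o a) ∩ openConn b a : Set (BondConfig V)) = (openConn b a ∩ twoClusterEv a c) \ openConn o a from by
        ext ω; simp only [mem_inter_iff, mem_sdiff]; tauto]
  rw [s1, s2, s3, s4] at key
  have h₃ : 0 ≤ (prodBernoulli w).real (openConn o a ∩ openConn b a ∩ twoClusterEv a c) := measureReal_nonneg
  nlinarith [key, h₃]

/-- **`TwoClusterAssocPos → TwoClusterFourPointPos`.** [cite: KozmaNitzan2024, Thm. 1 (p. 7)] [cite: VandenbergHaggstromKahn2005, Thm. 1.5 (p. 7)] -/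
theorem twoClusterFourPointPos_of_assocPos (h : TwoClusterAssocPos) : TwoClusterFourPointPos :=
  fun n => twoClusterFourPointOn_of_assocOn (h n)

/-! ### The avoidance-conditioned strengthening is false -/

/-- **Positive association of `C_a` given `{a ↮ X} ∩ {k = 2}` for a SET `X`** — the literal two-cluster analogue of vdBHK Thm. 1.2
(there: any `X`, no level constraint, TRUE).  FALSE already for `|X| = 2` (`not_twoClusterAvoidAssocOn_fin_five`); the case `X = {c}` is
`TwoClusterAssocOn` (`avoidEv_singleton`). [cite: VandenbergHaggstromKahn2005, Thm. 1.2 (p. 5)] -/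
def TwoClusterAvoidAssocOn (V : Type*) [Fintype V] : Prop :=
  ∀ (w : Sym2 V → unitInterval) (a : V) (X : Set V) (𝒰 𝒱 : Set (Set V)), IsUpperSet 𝒰 → IsUpperSet 𝒱 →
    (prodBernoulli w).real (clusterIn a 𝒰 ∩ (avoidEv a X ∩ levelSet V 2)) *
        (prodBernoulli w).real (clusterIn a 𝒱 ∩ (avoidEv a X ∩ levelSet V 2)) ≤
      (prodBernoulli w).real (clusterIn a 𝒰 ∩ clusterIn a 𝒱 ∩ (avoidEv a X ∩ levelSet V 2)) *
        (prodBernoulli w).real (avoidEv a X ∩ levelSet V 2)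

/-- The avoidance form with `X = {c}` is CA₂. [cite: VandenbergHaggstromKahn2005, Thm. 1.2 (p. 5)] -/
theorem twoClusterAssocOn_of_avoidAssocOn (h : TwoClusterAvoidAssocOn V) : TwoClusterAssocOn V := by
  intro w a c 𝒰 𝒱 h𝒰 h𝒱
  have := h w a {c} 𝒰 𝒱 h𝒰 h𝒱
  rwa [avoidEv_singleton] at this

namespace TwoClusterCex

/-- `K_{2,3}` on `Fin 5`: apexes `0, 1`, leaves `2, 3, 4`, pairs `02, 03, 04, 12, 13, 14`, all parameters `1/2`; `q = 1` (product measure).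
[cite: Grimmett2006, §1.4 eq. (1.20) (p. 15)] -/
abbrev k23 : RCEval := ⟨5, 6, ![0, 0, 0, 1, 1, 1], ![2, 3, 4, 2, 3, 4], ![1 / 2, 1 / 2, 1 / 2, 1 / 2, 1 / 2, 1 / 2], 1⟩

/-- Validity of the data set. [folklore] -/
theorem valid : k23.Valid := by decide +kernel

/-- `{a ↮ X} ∩ {k = 2}` for `a = 2`, `X = {3, 4}`, as a Boolean. [folklore] -/
def pE (t : Finset (Fin 6)) : Bool := (!(k23.reachB t 2 3) && !(k23.reachB t 2 4)) && decide (k23.kB t = 2)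
/-- `{0 ∈ C_a} ∩ {a ↮ X} ∩ {k = 2}`. [folklore] -/
def pU (t : Finset (Fin 6)) : Bool := k23.reachB t 2 0 && pE t
/-- `{1 ∈ C_a} ∩ {a ↮ X} ∩ {k = 2}`. [folklore] -/
def pV (t : Finset (Fin 6)) : Bool := k23.reachB t 2 1 && pE t
/-- `{0 ∈ C_a} ∩ {1 ∈ C_a} ∩ {a ↮ X} ∩ {k = 2}`. [folklore] -/
def pUV (t : Finset (Fin 6)) : Bool := (k23.reachB t 2 0 && k23.reachB t 2 1) && pE t

/-- `P({a ↮ X} ∩ {k = 2}) = 7/64`. [cite: Grimmett2006, §1.4 eq. (1.20) (p. 15)] -/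
theorem mE : k23.massQ pE = 7 / 64 := by decide +kernel
/-- `P(0 ∈ C_a, a ↮ X, k = 2) = 1/64`. [cite: Grimmett2006, §1.4 eq. (1.20) (p. 15)] -/
theorem mU : k23.massQ pU = 1 / 64 := by decide +kernel
/-- `P(1 ∈ C_a, a ↮ X, k = 2) = 1/64`. [cite: Grimmett2006, §1.4 eq. (1.20) (p. 15)] -/
theorem mV : k23.massQ pV = 1 / 64 := by decide +kernel
/-- `P(0 ∈ C_a, 1 ∈ C_a, a ↮ X, k = 2) = 0` (the complement `{3,4}` of `{0,1,2}` is disconnected). [cite: Grimmett2006, §1.4 eq. (1.20) (p. 15)] -/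
theorem mUV : k23.massQ pUV = 0 := by decide +kernel
/-- `Z = 1` (product measure). [folklore] -/
theorem z_eq : k23.ZQ = 1 := by decide +kernel

/-- The product measure of the data set as an `RCEval` measure (`q = 1`). [cite: Grimmett2006, §1.2 (p. 4)] -/
theorem prodBernoulli_eq : prodBernoulli k23.w = rcMeasureW k23.w ((k23.q : ℚ) : ℝ) ∅ := by
  rw [show ((k23.q : ℚ) : ℝ) = 1 by norm_num, rcMeasureW_one]

/-- Membership in `{a ↮ X} ∩ {k = 2}` in Boolean form. [folklore] -/
theorem mem_pE (t : Finset (Fin 6)) :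
    k23.conf t ∈ (avoidEv (2 : Fin 5) ({3, 4} : Set (Fin 5)) ∩ levelSet (Fin 5) 2 : Set (BondConfig (Fin 5))) ↔ pE t = true := by
  have e23 := k23.reachB_iff t 2 3
  have e24 := k23.reachB_iff t 2 4
  rw [Set.mem_inter_iff, mem_levelSet_iff, RCEval.clusterCount_conf]
  simp only [avoidEv, Set.mem_setOf_eq, Set.mem_insert_iff, Set.mem_singleton_iff, forall_eq_or_imp, forall_eq, ← e23, ← e24, pE,
    Bool.and_eq_true, Bool.not_eq_eq_eq_not, Bool.not_true, decide_eq_true_eq]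
  cases k23.reachB t 2 3 <;> cases k23.reachB t 2 4 <;> simp

/-- Membership `{0 ∈ C_a} ∩ …` in Boolean form. [folklore] -/
theorem mem_pU (t : Finset (Fin 6)) :
    k23.conf t ∈ (clusterIn (2 : Fin 5) {S | (0 : Fin 5) ∈ S} ∩ (avoidEv (2 : Fin 5) ({3, 4} : Set (Fin 5)) ∩ levelSet (Fin 5) 2) :
      Set (BondConfig (Fin 5))) ↔ pU t = true := by
  have e20 := k23.reachB_iff t 2 0
  rw [Set.mem_inter_iff, mem_pE, clusterIn_mem_eq_openConn, mem_openConn_iff', ← e20]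
  simp [pU]

/-- Membership `{1 ∈ C_a} ∩ …` in Boolean form. [folklore] -/
theorem mem_pV (t : Finset (Fin 6)) :
    k23.conf t ∈ (clusterIn (2 : Fin 5) {S | (1 : Fin 5) ∈ S} ∩ (avoidEv (2 : Fin 5) ({3, 4} : Set (Fin 5)) ∩ levelSet (Fin 5) 2) :
      Set (BondConfig (Fin 5))) ↔ pV t = true := by
  have e21 := k23.reachB_iff t 2 1
  rw [Set.mem_inter_iff, mem_pE, clusterIn_mem_eq_openConn, mem_openConn_iff', ← e21]
  simp [pV]

/-- Membership `{0 ∈ C_a} ∩ {1 ∈ C_a} ∩ …` in Boolean form. [folklore] -/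
theorem mem_pUV (t : Finset (Fin 6)) :
    k23.conf t ∈ (clusterIn (2 : Fin 5) {S | (0 : Fin 5) ∈ S} ∩ clusterIn (2 : Fin 5) {S | (1 : Fin 5) ∈ S} ∩
        (avoidEv (2 : Fin 5) ({3, 4} : Set (Fin 5)) ∩ levelSet (Fin 5) 2) : Set (BondConfig (Fin 5))) ↔ pUV t = true := by
  have e20 := k23.reachB_iff t 2 0
  have e21 := k23.reachB_iff t 2 1
  rw [Set.mem_inter_iff, Set.mem_inter_iff, mem_pE, clusterIn_mem_eq_openConn, clusterIn_mem_eq_openConn, mem_openConn_iff',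
    mem_openConn_iff', ← e20, ← e21]
  simp only [pUV, Bool.and_eq_true, and_assoc]

end TwoClusterCex

open TwoClusterCex in
/-- **The avoidance-conditioned two-cluster association FAILS on `Fin 5`** (`K_{2,3}`, all parameters `1/2`, `a = 2`, `X = {3,4}`,
`𝒰 = {S ∋ 0}`, `𝒱 = {S ∋ 1}`): `(1/64)·(1/64) > 0 · (7/64)`. [cite: VandenbergHaggstromKahn2005, Thm. 1.2 (p. 5)]
[cite: Grimmett2006, §1.4 eq. (1.20) (p. 15)] -/
theorem not_twoClusterAvoidAssocOn_fin_five : ¬ TwoClusterAvoidAssocOn (Fin 5) := by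
  intro h
  have key := h k23.w 2 {3, 4} {S | (0 : Fin 5) ∈ S} {S | (1 : Fin 5) ∈ S} (isUpperSet_mem 0) (isUpperSet_mem 1)
  rw [prodBernoulli_eq, RCEval.real_eq_massQ_div valid (P := pU) mem_pU, RCEval.real_eq_massQ_div valid (P := pV) mem_pV,
    RCEval.real_eq_massQ_div valid (P := pUV) mem_pUV, RCEval.real_eq_massQ_div valid (P := pE) mem_pE, mU, mV, mUV, mE, z_eq] at key
  push_cast at key
  norm_num at key

/-- **Hence no universal avoidance form**: `¬ ∀ n, TwoClusterAvoidAssocOn (Fin n)`. [cite: VandenbergHaggstromKahn2005, Thm. 1.2 (p. 5)] -/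
theorem not_twoClusterAvoidAssoc_all : ¬ ∀ n : ℕ, TwoClusterAvoidAssocOn (Fin n) :=
  fun h => not_twoClusterAvoidAssocOn_fin_five (h 5)

end FK

end Summit.CriticalPhenomena.PercolationContinuityZ3.Theorems

end
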